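import Summits.BirchSwinnertonDyer.BirchSwinnertonDyer.Theorems.SignedLowerHalvesSmallImageLowerHalfBothSignsRttJunctionShaPairingNat
import Summits.BirchSwinnertonDyer.BirchSwinnertonDyer.Theorems.SignedLowerHalvesSmallImageLowerHalfBothSignsRttJunctionShaRigidity
import Literature.NumberTheory.EllipticCurves.IwasawaSelmerDualFunctorialityProofs
import HarnessLib

/-!
# Route `SignedLowerHalves`, crux L `SmallImageLowerHalfBothSigns` (stmt-BirchSwinnertonDyer-23599), line `rtt_w3` v33 — stub S3α″ (`stub_junctionShaPi_ns`),
# brick α5′-4b: THE POITOU–TATE SOCKET — the `Λ`-LINEAR map `π : Hom(U, ℚ/ℤ) → 𝐇²_{Iw,P}` assembled from the layer dualities, and its RANGE modulo gluing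

INPUTS hand `bsd-inputs-honda-p1` g29 under LEAD `cruxlead-stmt-BirchSwinnertonDyer-23599` (cell `bsd-ssimc`); helper `--supports stmt-BirchSwinnertonDyer-23599`.
DEFINITIONS WITH BODIES (`shaValO`, `levelMapO`, `piFun`, `piHom`, `piLinear`) + THEOREMS; no named fact, no instance, no `sorry`. The one-variable `𝒪`-coefficient
twin of the tree's IMC socket `Literature/…/EllipticUnits/ImaginaryQuadraticMainConjectureClassGroupRow.lean` (JLK 2011 Lemma 5.8, `LayerDuality.exists_linearMap`,
`mem_range_iff_of_glue`) for honda's pinned datum `I : CycIwasawaCohomologyDataO S κ γ θ′ P 2` and an ABSTRACT discrete side: a `p`-primary group `U` with an endomorphism `cU`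
(`conj_{γ⁻¹}` in the application: `U = Sel_str(K_∞, A)`, `γ = γK⁻¹`, `cU = conj_{γK}`), `cU − 1` locally nilpotent (`hU : IsLocNil p (cU − 1)`, lambda-p1's `isLocNil_conjStrict_sub_one`),
and additive comparison maps `ι n k : Ш¹_P(K_n, A[p^k]) → U` compatible with restriction, inclusion and conjugation (`hιres`, `hιincl`, `hιc`).

* (§1 = the sibling file `…RttJunctionShaRigidity`: `toTwoVar`/`ofTwoVar`, `isLocNil₂_cycLayer`, ★ `proj_smul_eq_selfModule_smul`.)
* §2 `levelMapO n k : Hom(U, ℚ/ℤ) →+ Ш²_P(K_n, X_k)` (`IwasawaDual.dualHom` through the perfect `pairO n k`: `⟨levelMapO y, z⟩ = y (ι z)`, `pairO_levelMapO`), compatible with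
  cores/red (`coe_levelMapO_cores/_red`, from `pairO_cores/_red` + `hιres/hιincl`); `piFun`/`piHom : Hom(U, ℚ/ℤ) →+ I.H` by (P4)/(P3) (`proj_piHom`).
* §3 pins `levelMapO_smulFun_X` (`X` ↔ `pairO_conj` + `hιc`) and `levelMapO_smulFun_C` (constants ↔ `ℤ/p^k`), ★★ `levelMapO_smul` (`levelMapO (F • y) = F • levelMapO y`,
  `F • y` in `hU.module`, again `map_smul_of_commute`), ★★★ `piLinear : Hom(U, ℚ/ℤ) →ₗ[Λ] I.H` (`letI := I.moduleIwasawa; letI := hU.module`), `proj_piLinear`.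
* §4 `levelMapO_eq_zero_iff`, `piLinear_eq_zero_iff`; ★★ `piLinear_mem_range_iff_of_glue` — if compatible families of characters of the `Ш¹_P(K_n, A[p^k])` glue to
  characters of `U` (`hglue`), then `b ∈ range π ↔ ∀ n k, I.proj n k b ∈ Ш²_P(K_n, X_k)`.
The plugs (`hglue` from a kernel lemma + Baer; `ι` into `Sel_str` with `U := strictSelmer …`; `A := Cofree θ F`) are the sequel bricks.
HONEST FRAMING: algebraic assembly; α5′, S3α″, crux L and BSD are NOT proved here and remain OPEN; BSD is proved for NO curve.
References: [JohnsonLeungKings2011] §4.2 Def. 4.2 (94), §5.4 Lemma 5.8; [MilneADT2006] I Thm. 4.10 (a), §4 p. 65; [Lang1990] Ch. 5 §1; [GreenbergLNM1716] §1; [Washington1997] §13.2;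
[NeukirchSchmidtWingberg2008] (8.6.10).
-/

set_option autoImplicit false
set_option linter.dupNamespace false -- D-0017: single-problem summit, the namespace repeats the problem name by design
noncomputable section

open scoped Classical
open NumberField IsDedekindDomain Field Function CategoryTheory PowerSeries

namespace Summit.BirchSwinnertonDyer.BirchSwinnertonDyer.Theorems.SmallImageRttJunctionSha

open Literature.NumberTheory.EllipticCurves Literature.NumberTheory.EllipticCurves.IwasawaDual Literature.NumberTheory.GaloisRepresentations
  Literature.NumberTheory.GaloisRepresentations.DiscreteGaloisModule Literature.NumberTheory.GaloisCohomology Literature.NumberTheory.GaloisCohomology.ShaLayer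
  Literature.NumberTheory.ComplexMultiplication.EllipticUnits Literature.NumberTheory.ComplexMultiplication.EllipticUnits.JohnsonLeungKings2011
  Summit.BirchSwinnertonDyer.BirchSwinnertonDyer.Theorems.SmallImageRttD2J1 Summit.BirchSwinnertonDyer.BirchSwinnertonDyer.Theorems.SmallImageRttD2Seq

/-! ## §2 The level maps `Hom(U, ℚ/ℤ) → Ш²_P(K_n, X_k)` and the map `π` -/

section Socket

variable {K : Type} [Field K] [NumberField K] {p : ℕ} [Fact p.Prime] (S : Set (PadicAlgCl p)) [FiniteDimensional ℚ_[p] (padicCoeffField S)]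
  (κ : ZpExtension K p) (γ : absoluteGaloisGroup K) (θ' : absoluteGaloisGroup K →ₜ* (padicCoeffIntegers S)ˣ) (P : Set (HeightOneSpectrum (𝓞 K)))
  (M : Type) [AddCommGroup M] [DistribMulAction (absoluteGaloisGroup K) M] [TopologicalSpace M] [DiscreteTopology M]
  (hstab : ∀ m : M, IsOpen (MulAction.stabilizer (absoluteGaloisGroup K) m : Set (absoluteGaloisGroup K)))
  (B : ∀ k : ℕ, OMuCarrier K S (p ^ k) →+ ↥(torsionPow M p k) →+ MuCarrier K (p ^ k))
  (hB : ∀ (k : ℕ) (σ : absoluteGaloisGroup K) (x : OMuCarrier K S (p ^ k)) (m : ↥(torsionPow M p k)),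
    B k (muTwistO S θ' k σ x) (torsRep M hstab p k σ m) = mu K (p ^ k) σ (B k x m))
  (hPT : poitouTate_shaRestricted_tateDual_natural_at K P)
  [hFin : ∀ n : ℕ, Fintype (absoluteGaloisGroup K ⧸ κ.layerSubgroup n)]
  (hNP : ∀ n : ℕ, ramificationSubgroup K P ≤ κ.layerSubgroup n)
  (hμ : ∀ k : ℕ, ramificationSubgroup K P ≤ ContinuousRep.ker (muTwistO S θ' k))
  (hA : ∀ k : ℕ, ramificationSubgroup K P ≤ ContinuousRep.ker (torsRep M hstab p k))
  (hpP : ∀ v : HeightOneSpectrum (𝓞 K), ((p : ℕ) : 𝓞 K) ∈ v.asIdeal → v ∈ P)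
  (hperf : ∀ k : ℕ, Bijective fun m : ↥(torsionPow M p k) ↦ (B k).flip m)
  -- the abstract discrete side
  (U : Type) [AddCommGroup U] (ι : ∀ n k : ℕ, ↥(layerShaRestricted P (torsRep M hstab p k) (κ.layerSubgroup n) 1) →+ U)

include hpP hperf

omit [FiniteDimensional ℚ_[p] (padicCoeffField S)] hFin hpP hperf in
/-- The inclusion `Ш²_P(K_n, X_k) ↪ H²((U_n)_P, X_k)` with codomain SPELLED as honda's layer group `cycLayerCohO` (so that the layer's module structures are found on its values).
[cite: MilneADT2006, I §4 (p. 56)] -/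
def shaValO (n k : ℕ) : ↥(layerShaRestricted P (muTwistO S θ' k) (κ.layerSubgroup n) 2) →+ cycLayerCohO S κ θ' P n k 2 :=
  (layerShaRestricted P (muTwistO S θ' k) (κ.layerSubgroup n) 2).subtype

omit [FiniteDimensional ℚ_[p] (padicCoeffField S)] hFin hpP hperf in
/-- `shaValO` is the coercion. [folklore] -/
theorem shaValO_apply (n k : ℕ) (x : ↥(layerShaRestricted P (muTwistO S θ' k) (κ.layerSubgroup n) 2)) : shaValO S κ θ' P n k x = x.1 := rfl

omit [FiniteDimensional ℚ_[p] (padicCoeffField S)] hFin hpP hperf in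
/-- `shaValO` is injective. [folklore] -/
theorem shaValO_injective (n k : ℕ) : Function.Injective (shaValO S κ θ' P n k) := Subtype.val_injective

omit [FiniteDimensional ℚ_[p] (padicCoeffField S)] hFin hpP hperf in
include hNP hμ in
/-- Membership helper: `cor y ∈ Ш²` for `y ∈ Ш²` (subtype form). [cite: MilneADT2006, I §4 (p. 65)] -/
theorem cores_val_mem (n k : ℕ) (y : ↥(layerShaRestricted P (muTwistO S θ' k) (κ.layerSubgroup (n + 1)) 2)) :
    cycLayerCoresO S κ θ' P n k 2 y.1 ∈ layerShaRestricted P (muTwistO S θ' k) (κ.layerSubgroup n) 2 :=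
  cycLayerCoresO_mem_layerShaRestricted S κ θ' P hNP hμ n k y.2

omit [FiniteDimensional ℚ_[p] (padicCoeffField S)] hFin hpP hperf in
include hNP hμ in
/-- Membership helper: `red y ∈ Ш²` for `y ∈ Ш²` (subtype form). [cite: MilneADT2006, I §4 (p. 56)] -/
theorem red_val_mem (n k : ℕ) (y : ↥(layerShaRestricted P (muTwistO S θ' (k + 1)) (κ.layerSubgroup n) 2)) :
    cycLayerRedO S κ θ' P n k 2 y.1 ∈ layerShaRestricted P (muTwistO S θ' k) (κ.layerSubgroup n) 2 :=
  cycLayerRedO_mem_layerShaRestricted S κ θ' P hNP hμ n k y.2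

omit [FiniteDimensional ℚ_[p] (padicCoeffField S)] hFin hpP hperf in
/-- Membership helper: `conj_γ y ∈ Ш²` for `y ∈ Ш²` (subtype form). [cite: MilneADT2006, I §4 (p. 56)] -/
theorem conj_val_mem (n k : ℕ) (δ : absoluteGaloisGroup K) (y : ↥(layerShaRestricted P (muTwistO S θ' k) (κ.layerSubgroup n) 2)) :
    cycLayerConjO S κ θ' P n k 2 δ y.1 ∈ layerShaRestricted P (muTwistO S θ' k) (κ.layerSubgroup n) 2 :=
  cycLayerConjO_mem_layerShaRestricted S κ θ' P n k δ y.2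

/-- `pairO_cores` for a subtype element. [cite: MilneADT2006, I §4 p. 65] -/
theorem pairO_cores' (n k : ℕ) (y : ↥(layerShaRestricted P (muTwistO S θ' k) (κ.layerSubgroup (n + 1)) 2)) (z : ↥(layerShaRestricted P (torsRep M hstab p k) (κ.layerSubgroup n) 1)) :
    pairO S κ θ' P M hstab B hB hPT hNP hμ hA n k ⟨cycLayerCoresO S κ θ' P n k 2 y.1, cores_val_mem S κ θ' P hNP hμ n k y⟩ z =
      pairO S κ θ' P M hstab B hB hPT hNP hμ hA (n + 1) k y (resYO κ P M hstab hNP hA n k z) := by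
  obtain ⟨y, hy⟩ := y
  exact pairO_cores S κ θ' P M hstab B hB hPT hNP hμ hA hpP n k (hperf k) y hy z

/-- `pairO_red` for a subtype element. [cite: MilneADT2006, I §4 p. 65] -/
theorem pairO_red' (n k : ℕ) (hBred : ∀ (x : OMuCarrier K S (p ^ (k + 1))) (m : ↥(torsionPow M p k)),
      muVal K (p ^ k) (B k (oMuRed S k x) m) = muVal K (p ^ (k + 1)) (B (k + 1) x (AddSubgroup.inclusion (torsionPow_mono (M := M) (p := p) (Nat.le_succ k)) m)))
    (y : ↥(layerShaRestricted P (muTwistO S θ' (k + 1)) (κ.layerSubgroup n) 2)) (z : ↥(layerShaRestricted P (torsRep M hstab p k) (κ.layerSubgroup n) 1)) :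
    pairO S κ θ' P M hstab B hB hPT hNP hμ hA n k ⟨cycLayerRedO S κ θ' P n k 2 y.1, red_val_mem S κ θ' P hNP hμ n k y⟩ z =
      pairO S κ θ' P M hstab B hB hPT hNP hμ hA n (k + 1) y (inclYO κ P M hstab hNP hA n k z) := by
  obtain ⟨y, hy⟩ := y
  exact pairO_red S κ θ' P M hstab B hB hPT hNP hμ hA hpP n k (hperf k) hBred y hy z

/-- `pairO_conj` for a subtype element. [cite: MilneADT2006, I §4 p. 65] -/
theorem pairO_conj' (n k : ℕ) (δ : absoluteGaloisGroup K) (y : ↥(layerShaRestricted P (muTwistO S θ' k) (κ.layerSubgroup n) 2))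
    (z : ↥(layerShaRestricted P (torsRep M hstab p k) (κ.layerSubgroup n) 1)) :
    pairO S κ θ' P M hstab B hB hPT hNP hμ hA n k ⟨cycLayerConjO S κ θ' P n k 2 δ y.1, conj_val_mem S κ θ' P n k δ y⟩ z =
      pairO S κ θ' P M hstab B hB hPT hNP hμ hA n k y (conjYO κ P M hstab n k δ⁻¹ z) := by
  obtain ⟨y, hy⟩ := y
  exact pairO_conj S κ θ' P M hstab B hB hPT hNP hμ hA hpP n k (hperf k) δ y hy z

/-- **The level map `f_{n,k} : Hom(U, ℚ/ℤ) → Ш²_P(K_n, X_k)`**: the transpose of `ι_{n,k}` through the PERFECT pairing `pairO n k` (`IwasawaDual.dualHom`): `f y` is THE class with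
`⟨f y, z⟩ = y (ι z)` for all `z`. [cite: JohnsonLeungKings2011, §5.4 Lemma 5.8 (arXiv p0015:L150–165)] [cite: Washington1997, §13.2] -/
def levelMapO (n k : ℕ) : (U →+ AddCircle (1 : ℚ)) →+ ↥(layerShaRestricted P (muTwistO S θ' k) (κ.layerSubgroup n) 2) :=
  IwasawaDual.dualHom (pairO S κ θ' P M hstab B hB hPT hNP hμ hA n k) (pairO_bijective S κ θ' P M hstab B hB hPT hNP hμ hA hpP n k (hperf k))
    (AddMonoidHom.id (U →+ AddCircle (1 : ℚ))) (ι n k)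

/-- The defining identity `⟨f_{n,k} y, z⟩ = y (ι z)`. [cite: JohnsonLeungKings2011, §5.4 Lemma 5.8] -/
theorem pairO_levelMapO (n k : ℕ) (y : U →+ AddCircle (1 : ℚ)) (z : layerShaRestricted P (torsRep M hstab p k) (κ.layerSubgroup n) 1) :
    pairO S κ θ' P M hstab B hB hPT hNP hμ hA n k (levelMapO S κ θ' P M hstab B hB hPT hNP hμ hA hpP hperf U ι n k y) z = y (ι n k z) :=
  IwasawaDual.toDual_dualHom_apply _ _ _ _ y z

/-- Two classes of `Ш²_P(K_n, X_k)` with the same pairing values are equal (perfectness). [cite: MilneADT2006, I Thm. 4.10 (a)] -/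
theorem eq_of_forall_pairO_eq (n k : ℕ) {a b : ↥(layerShaRestricted P (muTwistO S θ' k) (κ.layerSubgroup n) 2)}
    (h : ∀ z, pairO S κ θ' P M hstab B hB hPT hNP hμ hA n k a z = pairO S κ θ' P M hstab B hB hPT hNP hμ hA n k b z) : a = b :=
  (pairO_bijective S κ θ' P M hstab B hB hPT hNP hμ hA hpP n k (hperf k)).1 (AddMonoidHom.ext h)

variable (hιres : ∀ (n k : ℕ) (z : layerShaRestricted P (torsRep M hstab p k) (κ.layerSubgroup n) 1), ι (n + 1) k (resYO κ P M hstab hNP hA n k z) = ι n k z)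
  (hιincl : ∀ (n k : ℕ) (z : layerShaRestricted P (torsRep M hstab p k) (κ.layerSubgroup n) 1), ι n (k + 1) (inclYO κ P M hstab hNP hA n k z) = ι n k z)

include hιres in
/-- **Compatibility with corestriction**: `cor (f_{n+1,k} y) = f_{n,k} y` (`pairO_cores` + `hιres`). [cite: JohnsonLeungKings2011, §5.4 Lemma 5.8] -/
theorem coe_levelMapO_cores (n k : ℕ) (y : U →+ AddCircle (1 : ℚ)) :
    cycLayerCoresO S κ θ' P n k 2 (levelMapO S κ θ' P M hstab B hB hPT hNP hμ hA hpP hperf U ι (n + 1) k y).1 = (levelMapO S κ θ' P M hstab B hB hPT hNP hμ hA hpP hperf U ι n k y).1 := by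
  have h : (⟨cycLayerCoresO S κ θ' P n k 2 (levelMapO S κ θ' P M hstab B hB hPT hNP hμ hA hpP hperf U ι (n + 1) k y).1, cores_val_mem S κ θ' P hNP hμ n k (levelMapO S κ θ' P M hstab B hB hPT hNP hμ hA hpP hperf U ι (n + 1) k y)⟩ :
      ↥(layerShaRestricted P (muTwistO S θ' k) (κ.layerSubgroup n) 2)) = levelMapO S κ θ' P M hstab B hB hPT hNP hμ hA hpP hperf U ι n k y :=
    eq_of_forall_pairO_eq S κ θ' P M hstab B hB hPT hNP hμ hA hpP hperf n k fun z ↦ by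
      simp only [pairO_cores' S κ θ' P M hstab B hB hPT hNP hμ hA hpP hperf n k (levelMapO S κ θ' P M hstab B hB hPT hNP hμ hA hpP hperf U ι (n + 1) k y) z, pairO_levelMapO, hιres]
  exact congrArg Subtype.val h

include hιincl in
/-- **Compatibility with reduction**: `red (f_{n,k+1} y) = f_{n,k} y` (`pairO_red` + `hιincl`), under the level law `hBred` of the pairings. [cite: JohnsonLeungKings2011, §5.4 Lemma 5.8] -/
theorem coe_levelMapO_red (hBred : ∀ (k : ℕ) (x : OMuCarrier K S (p ^ (k + 1))) (m : ↥(torsionPow M p k)),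
      muVal K (p ^ k) (B k (oMuRed S k x) m) = muVal K (p ^ (k + 1)) (B (k + 1) x (AddSubgroup.inclusion (torsionPow_mono (M := M) (p := p) (Nat.le_succ k)) m)))
    (n k : ℕ) (y : U →+ AddCircle (1 : ℚ)) :
    cycLayerRedO S κ θ' P n k 2 (levelMapO S κ θ' P M hstab B hB hPT hNP hμ hA hpP hperf U ι n (k + 1) y).1 = (levelMapO S κ θ' P M hstab B hB hPT hNP hμ hA hpP hperf U ι n k y).1 := by
  have h : (⟨cycLayerRedO S κ θ' P n k 2 (levelMapO S κ θ' P M hstab B hB hPT hNP hμ hA hpP hperf U ι n (k + 1) y).1, red_val_mem S κ θ' P hNP hμ n k (levelMapO S κ θ' P M hstab B hB hPT hNP hμ hA hpP hperf U ι n (k + 1) y)⟩ :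
      ↥(layerShaRestricted P (muTwistO S θ' k) (κ.layerSubgroup n) 2)) = levelMapO S κ θ' P M hstab B hB hPT hNP hμ hA hpP hperf U ι n k y :=
    eq_of_forall_pairO_eq S κ θ' P M hstab B hB hPT hNP hμ hA hpP hperf n k fun z ↦ by
      simp only [pairO_red' S κ θ' P M hstab B hB hPT hNP hμ hA hpP hperf n k (hBred k) (levelMapO S κ θ' P M hstab B hB hPT hNP hμ hA hpP hperf U ι n (k + 1) y) z, pairO_levelMapO, hιincl]
  exact congrArg Subtype.val h

variable (hBred : ∀ (k : ℕ) (x : OMuCarrier K S (p ^ (k + 1))) (m : ↥(torsionPow M p k)),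
      muVal K (p ^ k) (B k (oMuRed S k x) m) = muVal K (p ^ (k + 1)) (B (k + 1) x (AddSubgroup.inclusion (torsionPow_mono (M := M) (p := p) (Nat.le_succ k)) m)))
  (I : CycIwasawaCohomologyDataO S κ γ θ' P 2)

include hιres hιincl hBred

/-- **The level maps glue** ((P4)): for every `y` there is `x ∈ I.H` with `proj n k x = f_{n,k} y` for all `n, k`. [cite: JohnsonLeungKings2011, Def. 4.2 (94), §5.4 Lemma 5.8] -/
theorem exists_proj_eq_levelMapO (y : U →+ AddCircle (1 : ℚ)) : ∃ x : I.H, ∀ n k, I.proj n k x = (levelMapO S κ θ' P M hstab B hB hPT hNP hμ hA hpP hperf U ι n k y).1 :=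
  I.proj_surjective (fun n k ↦ (levelMapO S κ θ' P M hstab B hB hPT hNP hμ hA hpP hperf U ι n k y).1)
    (fun n k ↦ coe_levelMapO_cores S κ θ' P M hstab B hB hPT hNP hμ hA hpP hperf U ι hιres n k y)
    (fun n k ↦ coe_levelMapO_red S κ θ' P M hstab B hB hPT hNP hμ hA hpP hperf U ι hιincl hBred n k y)

/-- **`π` as a function** (a choice of the glued element). [cite: JohnsonLeungKings2011, §5.4 Lemma 5.8] -/
def piFun (y : U →+ AddCircle (1 : ℚ)) : I.H :=
  Classical.choose (exists_proj_eq_levelMapO S κ γ θ' P M hstab B hB hPT hNP hμ hA hpP hperf U ι hιres hιincl hBred I y)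

/-- `proj n k (π y) = f_{n,k} y`. [cite: JohnsonLeungKings2011, §5.4 Lemma 5.8] -/
theorem proj_piFun (y : U →+ AddCircle (1 : ℚ)) (n k : ℕ) :
    I.proj n k (piFun S κ γ θ' P M hstab B hB hPT hNP hμ hA hpP hperf U ι hιres hιincl hBred I y) = (levelMapO S κ θ' P M hstab B hB hPT hNP hμ hA hpP hperf U ι n k y).1 :=
  Classical.choose_spec (exists_proj_eq_levelMapO S κ γ θ' P M hstab B hB hPT hNP hμ hA hpP hperf U ι hιres hιincl hBred I y) n k

/-- `π 0 = 0`. [folklore] -/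
theorem piFun_zero : piFun S κ γ θ' P M hstab B hB hPT hNP hμ hA hpP hperf U ι hιres hιincl hBred I 0 = 0 :=
  I.proj_injective _ fun n k ↦ by rw [proj_piFun, map_zero]; rfl

/-- `π (y + y') = π y + π y'` ((P3)). [folklore] -/
theorem piFun_add (y y' : U →+ AddCircle (1 : ℚ)) :
    piFun S κ γ θ' P M hstab B hB hPT hNP hμ hA hpP hperf U ι hιres hιincl hBred I (y + y') =
      piFun S κ γ θ' P M hstab B hB hPT hNP hμ hA hpP hperf U ι hιres hιincl hBred I y + piFun S κ γ θ' P M hstab B hB hPT hNP hμ hA hpP hperf U ι hιres hιincl hBred I y' := by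
  refine sub_eq_zero.mp (I.proj_injective _ fun n k ↦ ?_)
  rw [map_sub, map_add, proj_piFun, proj_piFun, proj_piFun, map_add]
  exact sub_eq_zero.mpr (AddSubgroup.coe_add _ _ _)

/-- **`π : Hom(U, ℚ/ℤ) →+ I.H`** (additive by (P3)). [cite: JohnsonLeungKings2011, §5.4 Lemma 5.8] -/
def piHom : (U →+ AddCircle (1 : ℚ)) →+ I.H where
  toFun := piFun S κ γ θ' P M hstab B hB hPT hNP hμ hA hpP hperf U ι hιres hιincl hBred I
  map_zero' := piFun_zero S κ γ θ' P M hstab B hB hPT hNP hμ hA hpP hperf U ι hιres hιincl hBred I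
  map_add' := piFun_add S κ γ θ' P M hstab B hB hPT hNP hμ hA hpP hperf U ι hιres hιincl hBred I

/-- `proj n k (π y) = f_{n,k} y`. [cite: JohnsonLeungKings2011, §5.4 Lemma 5.8] -/
theorem proj_piHom (y : U →+ AddCircle (1 : ℚ)) (n k : ℕ) :
    I.proj n k (piHom S κ γ θ' P M hstab B hB hPT hNP hμ hA hpP hperf U ι hιres hιincl hBred I y) = shaValO S κ θ' P n k (levelMapO S κ θ' P M hstab B hB hPT hNP hμ hA hpP hperf U ι n k y) :=
  proj_piFun S κ γ θ' P M hstab B hB hPT hNP hμ hA hpP hperf U ι hιres hιincl hBred I y n k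

/-! ## §3 `Λ`-linearity -/

variable (cU : AddMonoid.End U) (hU : IsLocNil p (cU - 1))
  (hιc : ∀ (n k : ℕ) (z : layerShaRestricted P (torsRep M hstab p k) (κ.layerSubgroup n) 1), ι n k (conjYO κ P M hstab n k γ⁻¹ z) = cU (ι n k z))

omit hιres hιincl hBred in
include hιc in
/-- **Pin `T`**: `f_{n,k} (y ∘ (cU − 1)) = conj_γ (f_{n,k} y) − f_{n,k} y` (`pairO_conj` + `hιc`: `⟨conj_γ f y − f y, z⟩ = y(ι(conj_{γ⁻¹} z)) − y(ι z)`).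
[cite: JohnsonLeungKings2011, §5.4 Lemma 5.8] [cite: GreenbergLNM1716, §1 (p. 60)] -/
theorem levelMapO_smulFun_X (n k : ℕ) (w : U →+ AddCircle (1 : ℚ)) :
    levelMapO S κ θ' P M hstab B hB hPT hNP hμ hA hpP hperf U ι n k (hU.smulFun PowerSeries.X w) =
      ⟨cycLayerConjO S κ θ' P n k 2 γ (levelMapO S κ θ' P M hstab B hB hPT hNP hμ hA hpP hperf U ι n k w).1, conj_val_mem S κ θ' P n k γ (levelMapO S κ θ' P M hstab B hB hPT hNP hμ hA hpP hperf U ι n k w)⟩ - levelMapO S κ θ' P M hstab B hB hPT hNP hμ hA hpP hperf U ι n k w :=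
  eq_of_forall_pairO_eq S κ θ' P M hstab B hB hPT hNP hμ hA hpP hperf n k fun z ↦ by
    simp only [pairO_levelMapO, hU.smulFun_X_apply, map_sub, AddMonoidHom.sub_apply,
      pairO_conj' S κ θ' P M hstab B hB hPT hNP hμ hA hpP hperf n k γ (levelMapO S κ θ' P M hstab B hB hPT hNP hμ hA hpP hperf U ι n k w) z, hιc, End_sub_apply, AddMonoid.End.coe_one, id_eq]

omit hιres hιincl hBred in
/-- **Constants act through `ℤ/p^k`**: `f_{n,k} (c • y) = (c mod p^k) • f_{n,k} y` (`Ш¹_P(K_n, A[p^k])` is `p^k`-torsion, `IsLocNil.smulFun_C_apply`). [cite: Lang1990, Ch. 5 §1] -/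
theorem levelMapO_smulFun_C (n k : ℕ) (c : ℤ_[p]) (w : U →+ AddCircle (1 : ℚ)) :
    levelMapO S κ θ' P M hstab B hB hPT hNP hμ hA hpP hperf U ι n k (hU.smulFun (PowerSeries.C c) w) = (PadicInt.toZModPow k c).val • levelMapO S κ θ' P M hstab B hB hPT hNP hμ hA hpP hperf U ι n k w :=
  eq_of_forall_pairO_eq S κ θ' P M hstab B hB hPT hNP hμ hA hpP hperf n k fun z ↦ by
    have hz : p ^ k • ι n k z = 0 := by rw [← (ι n k).map_nsmul, shaOneO_torsion κ P M hstab n k z, (ι n k).map_zero]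
    simp only [pairO_levelMapO, hU.smulFun_C_apply c w hz, map_nsmul, AddMonoidHom.nsmul_apply]

omit hιres hιincl hBred in
include hιc in
/-- ★★ **The level maps intertwine the `Λ`-actions**: `f_{n,k} (F • y) = F • f_{n,k} y`, `F • y` in the canonical structure `hU.module` on `Hom(U, ℚ/ℤ)` (`T ↦ y ∘ (cU − 1)`) and the
right-hand side in the layer's structure for `(conj_γ − 1, 0)` (pins `levelMapO_smulFun_X`, `T₂ ↦ 0`, `levelMapO_smulFun_C`, then `IsLocNil₂.map_smul_of_commute`).
[cite: Lang1990, Ch. 5 §1] [cite: GreenbergLNM1716, §1 (p. 60)] [cite: JohnsonLeungKings2011, §5.4 Lemma 5.8] -/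
theorem levelMapO_smul (n k : ℕ) (F : IwasawaAlgebra p) (y : U →+ AddCircle (1 : ℚ)) :
    shaValO S κ θ' P n k (levelMapO S κ θ' P M hstab B hB hPT hNP hμ hA hpP hperf U ι n k (letI := hU.module (A := AddCircle (1 : ℚ)); F • y)) =
      (letI := (isLocNil₂_cycLayer S κ γ θ' P n k).selfModule; toTwoVar p F • shaValO S κ θ' P n k (levelMapO S κ θ' P M hstab B hB hPT hNP hμ hA hpP hperf U ι n k y)) := by
  letI i1 : Module (IwasawaAlgebra p) (U →+ AddCircle (1 : ℚ)) := hU.module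
  letI i2 : Module (IwasawaAlgebra₂ p) (U →+ AddCircle (1 : ℚ)) := Module.compHom _ (ofTwoVar p)
  have hsm : ∀ (G : IwasawaAlgebra₂ p) (w : U →+ AddCircle (1 : ℚ)), G • w = hU.smulFun (ofTwoVar p G) w := fun _ _ ↦ rfl
  have h0 : ∀ w : U →+ AddCircle (1 : ℚ), hU.smulFun 0 w = 0 := fun w ↦ zero_smul (IwasawaAlgebra p) w
  have key := (isLocNil₂_cycLayer S κ γ θ' P n k).map_smul_of_commute (M := U →+ AddCircle (1 : ℚ)) (cycLayerConjEndO_sub_one_pow_apply_eq_zero S κ γ θ' P n k)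
    (zero_pow_apply_eq_zero S κ θ' P n k) (fun s ↦ levelCohO_torsion S P θ' (κ.isOpen_layerSubgroup n) k 2 s)
    ((shaValO S κ θ' P n k).comp (levelMapO S κ θ' P M hstab B hB hPT hNP hμ hA hpP hperf U ι n k))
    (fun w ↦ by
      simp only [AddMonoidHom.comp_apply, hsm, ofTwoVar_X, levelMapO_smulFun_X S κ γ θ' P M hstab B hB hPT hNP hμ hA hpP hperf U ι cU hU hιc n k w, map_sub, shaValO_apply, End_sub_apply,
        AddMonoid.End.coe_one, id_eq, cycLayerConjEndO_apply_eq])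
    (fun w ↦ by simp only [AddMonoidHom.comp_apply, hsm, ofTwoVar_C_X, h0, map_zero, AddMonoid.End.zero_apply])
    (fun c w ↦ by simp only [AddMonoidHom.comp_apply, hsm, ofTwoVar_C_C, levelMapO_smulFun_C S κ θ' P M hstab B hB hPT hNP hμ hA hpP hperf U ι cU hU n k c w, map_nsmul])
    (toTwoVar p F) y
  simp only [AddMonoidHom.comp_apply, hsm, ofTwoVar_toTwoVar] at key
  exact key

include hιc in
/-- ★★★ **`π` is `Λ`-LINEAR**: `π (F • y) = F • π y` for `Hom(U, ℚ/ℤ)` with `hU.module` and `I.H` with `I.moduleIwasawa` (both level structures are the canonical one, by `levelMapO_smul` and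
`proj_smul_eq_selfModule_smul`; (P3)). [cite: JohnsonLeungKings2011, §5.4 Lemma 5.8] [cite: Lang1990, Ch. 5 §1] -/
theorem piHom_smul (F : IwasawaAlgebra p) (y : U →+ AddCircle (1 : ℚ)) :
    piHom S κ γ θ' P M hstab B hB hPT hNP hμ hA hpP hperf U ι hιres hιincl hBred I (letI := hU.module (A := AddCircle (1 : ℚ)); F • y) =
      (letI := I.moduleIwasawa; F • piHom S κ γ θ' P M hstab B hB hPT hNP hμ hA hpP hperf U ι hιres hιincl hBred I y) := by
  refine sub_eq_zero.mp (I.proj_injective _ fun n k ↦ ?_)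
  simp only [map_sub, proj_piHom, levelMapO_smul S κ γ θ' P M hstab B hB hPT hNP hμ hA hpP hperf U ι cU hU hιc, proj_smul_eq_selfModule_smul, sub_self]

include hιc in
/-- ★★★ **THE `Λ`-LINEAR POITOU–TATE MAP `π : Hom(U, ℚ/ℤ) →ₗ[Λ] 𝐇²_{Iw,P}`** (`piHom` with `piHom_smul`). [cite: JohnsonLeungKings2011, §5.4 Lemma 5.8] [cite: NeukirchSchmidtWingberg2008, (8.6.10)] -/
def piLinear :
    letI := hU.module (A := AddCircle (1 : ℚ)); letI := I.moduleIwasawa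
    (U →+ AddCircle (1 : ℚ)) →ₗ[IwasawaAlgebra p] I.H :=
  letI := hU.module (A := AddCircle (1 : ℚ)); letI := I.moduleIwasawa
  { toFun := piHom S κ γ θ' P M hstab B hB hPT hNP hμ hA hpP hperf U ι hιres hιincl hBred I
    map_add' := map_add _
    map_smul' := fun F y ↦ piHom_smul S κ γ θ' P M hstab B hB hPT hNP hμ hA hpP hperf U ι hιres hιincl hBred I cU hU hιc F y }

/-- `proj n k (π y) = f_{n,k} y` for `piLinear`. [cite: JohnsonLeungKings2011, §5.4 Lemma 5.8] -/
theorem proj_piLinear (y : U →+ AddCircle (1 : ℚ)) (n k : ℕ) :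
    letI := hU.module (A := AddCircle (1 : ℚ)); letI := I.moduleIwasawa
    I.proj n k (piLinear S κ γ θ' P M hstab B hB hPT hNP hμ hA hpP hperf U ι hιres hιincl hBred I cU hU hιc y) =
      shaValO S κ θ' P n k (levelMapO S κ θ' P M hstab B hB hPT hNP hμ hA hpP hperf U ι n k y) :=
  proj_piHom S κ γ θ' P M hstab B hB hPT hNP hμ hA hpP hperf U ι hιres hιincl hBred I y n k

/-! ## §4 Kernel and range -/

omit hιres hιincl hBred in
/-- **Kernel at a level**: `f_{n,k} y = 0 ↔ y` kills the `ι_{n,k}`-image (perfectness). [cite: JohnsonLeungKings2011, §5.4 Lemma 5.8] [cite: MilneADT2006, I Thm. 4.10 (a)] -/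
theorem levelMapO_eq_zero_iff (n k : ℕ) (y : U →+ AddCircle (1 : ℚ)) :
    levelMapO S κ θ' P M hstab B hB hPT hNP hμ hA hpP hperf U ι n k y = 0 ↔ ∀ z, y (ι n k z) = 0 := by
  constructor
  · intro h z
    have e := pairO_levelMapO S κ θ' P M hstab B hB hPT hNP hμ hA hpP hperf U ι n k y z
    simp only [h, map_zero, AddMonoidHom.zero_apply] at e
    exact e.symm
  · intro h
    exact eq_of_forall_pairO_eq S κ θ' P M hstab B hB hPT hNP hμ hA hpP hperf n k fun z ↦ by simp only [pairO_levelMapO, h, map_zero, AddMonoidHom.zero_apply]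

/-- **Kernel**: `π y = 0 ↔ y` kills every `ι_{n,k}`-image. [cite: JohnsonLeungKings2011, §5.4 Lemma 5.8] -/
theorem piLinear_eq_zero_iff (y : U →+ AddCircle (1 : ℚ)) :
    letI := hU.module (A := AddCircle (1 : ℚ)); letI := I.moduleIwasawa
    piLinear S κ γ θ' P M hstab B hB hPT hNP hμ hA hpP hperf U ι hιres hιincl hBred I cU hU hιc y = 0 ↔ ∀ (n k : ℕ) (z), y (ι n k z) = 0 := by
  letI := hU.module (A := AddCircle (1 : ℚ)); letI := I.moduleIwasawa
  constructor
  · intro h n k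
    have e := proj_piLinear S κ γ θ' P M hstab B hB hPT hNP hμ hA hpP hperf U ι hιres hιincl hBred I cU hU hιc y n k
    simp only [h, map_zero] at e
    exact (levelMapO_eq_zero_iff S κ θ' P M hstab B hB hPT hNP hμ hA hpP hperf U ι n k y).1 (shaValO_injective S κ θ' P n k (e.symm.trans (shaValO S κ θ' P n k).map_zero.symm))
  · intro h
    refine I.proj_injective _ fun n k ↦ ?_
    simp only [proj_piLinear, (levelMapO_eq_zero_iff S κ θ' P M hstab B hB hPT hNP hμ hA hpP hperf U ι n k y).2 (h n k), map_zero]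

/-- ★★ **THE RANGE OF `π`, modulo gluing**: if every family of characters `χ_{n,k}` of the `Ш¹_P(K_n, A[p^k])`, compatible with restriction and inclusion, is `y ∘ ι_{n,k}` for one character `y` of `U`
(`hglue`: kernel control of the `ι` + injectivity of `ℚ/ℤ`), then `b ∈ range π ↔` every `proj n k b` lies in `Ш²_P(K_n, X_k)` — JLK's Lemma 5.8 «the cokernel of the row embeds in the local `H²`'s».
[cite: JohnsonLeungKings2011, §5.4 Lemma 5.8 (arXiv p0015:L150–p0016:L20)] [cite: MilneADT2006, I Thm. 4.10 (a)] -/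
theorem piLinear_mem_range_iff_of_glue
    (hglue : ∀ χ : ∀ n k : ℕ, ↥(layerShaRestricted P (torsRep M hstab p k) (κ.layerSubgroup n) 1) →+ AddCircle (1 : ℚ),
      (∀ (n k : ℕ) (z), χ (n + 1) k (resYO κ P M hstab hNP hA n k z) = χ n k z) →
      (∀ (n k : ℕ) (z), χ n (k + 1) (inclYO κ P M hstab hNP hA n k z) = χ n k z) →
        ∃ y : U →+ AddCircle (1 : ℚ), ∀ (n k : ℕ) (z), y (ι n k z) = χ n k z)
    (b : I.H) :
    letI := hU.module (A := AddCircle (1 : ℚ)); letI := I.moduleIwasawa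
    b ∈ LinearMap.range (piLinear S κ γ θ' P M hstab B hB hPT hNP hμ hA hpP hperf U ι hιres hιincl hBred I cU hU hιc) ↔
      ∀ n k : ℕ, I.proj n k b ∈ layerShaRestricted P (muTwistO S θ' k) (κ.layerSubgroup n) 2 := by
  letI := hU.module (A := AddCircle (1 : ℚ)); letI := I.moduleIwasawa
  constructor
  · rintro ⟨y, rfl⟩ n k
    rw [proj_piLinear]
    exact (levelMapO S κ θ' P M hstab B hB hPT hNP hμ hA hpP hperf U ι n k y).2
  · intro hb
    -- the compatible family of characters `χ_{n,k} := ⟨proj b, ·⟩`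
    obtain ⟨y, hy⟩ := hglue (fun n k ↦ pairO S κ θ' P M hstab B hB hPT hNP hμ hA n k ⟨I.proj n k b, hb n k⟩)
      (fun n k z ↦ (pairO_cores' S κ θ' P M hstab B hB hPT hNP hμ hA hpP hperf n k ⟨I.proj (n + 1) k b, hb (n + 1) k⟩ z).symm.trans
        (congrArg (fun a ↦ pairO S κ θ' P M hstab B hB hPT hNP hμ hA n k a z) (Subtype.ext (I.proj_cores n k b))))
      (fun n k z ↦ (pairO_red' S κ θ' P M hstab B hB hPT hNP hμ hA hpP hperf n k (hBred k) ⟨I.proj n (k + 1) b, hb n (k + 1)⟩ z).symm.trans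
        (congrArg (fun a ↦ pairO S κ θ' P M hstab B hB hPT hNP hμ hA n k a z) (Subtype.ext (I.proj_red n k b))))
    refine ⟨y, sub_eq_zero.mp (I.proj_injective _ fun n k ↦ ?_)⟩
    rw [map_sub, sub_eq_zero, proj_piLinear]
    have h : levelMapO S κ θ' P M hstab B hB hPT hNP hμ hA hpP hperf U ι n k y = ⟨I.proj n k b, hb n k⟩ :=
      eq_of_forall_pairO_eq S κ θ' P M hstab B hB hPT hNP hμ hA hpP hperf n k fun z ↦ by simp only [pairO_levelMapO, hy]
    exact congrArg (shaValO S κ θ' P n k) h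

end Socket

end Summit.BirchSwinnertonDyer.BirchSwinnertonDyer.Theorems.SmallImageRttJunctionSha

end
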